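import Summits.CriticalPhenomena.Ising3DConformalLimit.Theorems.ArmHyperscalingOneArmHyperscalingMirrorFaceDefs

/-!
# Face geometry of the translated plus box
(route ArmHyperscaling, crux `OneArmHyperscaling`, item stmt-CriticalPhenomena-15591, line
`mirror-face-saturation`, registered stub `stub_faceGeometry : FaceGeometry`)

Statement (`stub_faceGeometry`, literally the line's `def FaceGeometry : Prop` of the definitions
module `Theorems/ArmHyperscalingOneArmHyperscalingMirrorFaceDefs.lean`): on `ℤ³`, write
`x_n = evalSite n = n e₀`, `m = K n`, and let `face K n i` (`i : Fin 6`) be the six exterior faces of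
the translated box `x_n + Λ_m` (the planar patches `{y₀ = n ∓ (m + 1), |y₁|, |y₂| ≤ m}`,
`{|y₀ - n| ≤ m, y₁ = ∓(m + 1), |y₂| ≤ m}`, `{|y₀ - n| ≤ m, |y₁| ≤ m, y₂ = ∓(m + 1)}`).  Then for every
`L` with `K n + n + 1 ≤ L`:
* `x_n ∈ Λ_L = box 3 L` and `x_n` lies on none of the six faces;
* every face is contained in `Λ_L`;
* the six faces are pairwise disjoint.

Proof: linear integer arithmetic on the three coordinates.  Membership in each face and in the box
is first rewritten as a conjunction of (in)equalities between the coordinates `y 0, y 1, y 2` and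
the integers `n`, `K n`, `L` (`Fintype.mem_piFinset`, `Finset.mem_Icc`, `Finset.mem_singleton`);
every clause is then closed by `omega`.  For the inclusions the hypothesis `K n + n + 1 ≤ L` bounds
the extreme coordinates `y₀ = n + K n + 1 ≤ L` (face `+e₀`) and `y₀ = n - K n - 1 ≥ -L` (face `−e₀`);
for disjointness two distinct faces always differ in a pinned coordinate (faces `∓e₀` have
`y₀ = n ∓ (K n + 1)` while the other four have `|y₀ - n| ≤ K n`, faces `∓e₁` have `y₁ = ∓(K n + 1)`
while faces `∓e₂` have `|y₁| ≤ K n`, and opposite faces differ in the sign of the pinned coordinate).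

References: S. Friedli, Y. Velenik, *Statistical Mechanics of Lattice Systems* (CUP 2017), §3.2
(boxes `B(n) = {-n,…,n}^d`).  No definitions are introduced.
-/

namespace Summit.CriticalPhenomena.Ising3DConformalLimit.Cruxes.OneArmHyperscaling.MirrorFaceSaturation

open Literature.Probability.LatticeModels Finset

/-- The first coordinate of the evaluation site `x_n = n e₀` is `n`. -/
private theorem evalSite_apply_zero (n : ℕ) : evalSite n 0 = n := by
  simp [evalSite]

/-- The second coordinate of the evaluation site `x_n = n e₀` vanishes. -/
private theorem evalSite_apply_one (n : ℕ) : evalSite n 1 = 0 := by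
  simp [evalSite]

/-- The third coordinate of the evaluation site `x_n = n e₀` vanishes. -/
private theorem evalSite_apply_two (n : ℕ) : evalSite n 2 = 0 := by
  simp [evalSite]

/-- Membership in the centred box `Λ_L ⊆ ℤ³` in coordinates: `|y 0|, |y 1|, |y 2| ≤ L`
(Friedli–Velenik 2017, §3.2). -/
private theorem mem_box_three {L : ℕ} {y : Site 3} :
    y ∈ box 3 L ↔ (-(L : ℤ) ≤ y 0 ∧ y 0 ≤ L) ∧ (-(L : ℤ) ≤ y 1 ∧ y 1 ≤ L) ∧
      (-(L : ℤ) ≤ y 2 ∧ y 2 ≤ L) := by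
  simp [mem_box, Fin.forall_fin_succ]

/-- The face `−e₀` (`face K n 0 = facePatch K n`) in coordinates:
`y 0 = n - K n - 1`, `|y 1| ≤ K n`, `|y 2| ≤ K n`. -/
private theorem mem_face_zero {K n : ℕ} {y : Site 3} :
    y ∈ face K n 0 ↔ y 0 = (n : ℤ) - (K : ℤ) * n - 1 ∧
      (-((K : ℤ) * n) ≤ y 1 ∧ y 1 ≤ (K : ℤ) * n) ∧ (-((K : ℤ) * n) ≤ y 2 ∧ y 2 ≤ (K : ℤ) * n) := by
  simp [face, facePatch, Fintype.mem_piFinset, Fin.forall_fin_succ]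

/-- The face `+e₀` (`face K n 1`) in coordinates: `y 0 = n + K n + 1`, `|y 1| ≤ K n`, `|y 2| ≤ K n`. -/
private theorem mem_face_one {K n : ℕ} {y : Site 3} :
    y ∈ face K n 1 ↔ y 0 = (n : ℤ) + (K : ℤ) * n + 1 ∧
      (-((K : ℤ) * n) ≤ y 1 ∧ y 1 ≤ (K : ℤ) * n) ∧ (-((K : ℤ) * n) ≤ y 2 ∧ y 2 ≤ (K : ℤ) * n) := by
  simp [face, Fintype.mem_piFinset, Fin.forall_fin_succ]

/-- The face `−e₁` (`face K n 2`) in coordinates: `|y 0 - n| ≤ K n`, `y 1 = -K n - 1`, `|y 2| ≤ K n`. -/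
private theorem mem_face_two {K n : ℕ} {y : Site 3} :
    y ∈ face K n 2 ↔ ((n : ℤ) - (K : ℤ) * n ≤ y 0 ∧ y 0 ≤ (n : ℤ) + (K : ℤ) * n) ∧
      y 1 = -((K : ℤ) * n) - 1 ∧ (-((K : ℤ) * n) ≤ y 2 ∧ y 2 ≤ (K : ℤ) * n) := by
  simp [face, Fintype.mem_piFinset, Fin.forall_fin_succ]

/-- The face `+e₁` (`face K n 3`) in coordinates: `|y 0 - n| ≤ K n`, `y 1 = K n + 1`, `|y 2| ≤ K n`. -/
private theorem mem_face_three {K n : ℕ} {y : Site 3} :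
    y ∈ face K n 3 ↔ ((n : ℤ) - (K : ℤ) * n ≤ y 0 ∧ y 0 ≤ (n : ℤ) + (K : ℤ) * n) ∧
      y 1 = (K : ℤ) * n + 1 ∧ (-((K : ℤ) * n) ≤ y 2 ∧ y 2 ≤ (K : ℤ) * n) := by
  simp [face, Fintype.mem_piFinset, Fin.forall_fin_succ]

/-- The face `−e₂` (`face K n 4`) in coordinates: `|y 0 - n| ≤ K n`, `|y 1| ≤ K n`, `y 2 = -K n - 1`. -/
private theorem mem_face_four {K n : ℕ} {y : Site 3} :
    y ∈ face K n 4 ↔ ((n : ℤ) - (K : ℤ) * n ≤ y 0 ∧ y 0 ≤ (n : ℤ) + (K : ℤ) * n) ∧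
      (-((K : ℤ) * n) ≤ y 1 ∧ y 1 ≤ (K : ℤ) * n) ∧ y 2 = -((K : ℤ) * n) - 1 := by
  simp [face, Fintype.mem_piFinset, Fin.forall_fin_succ]

/-- The face `+e₂` (`face K n 5`) in coordinates: `|y 0 - n| ≤ K n`, `|y 1| ≤ K n`, `y 2 = K n + 1`. -/
private theorem mem_face_five {K n : ℕ} {y : Site 3} :
    y ∈ face K n 5 ↔ ((n : ℤ) - (K : ℤ) * n ≤ y 0 ∧ y 0 ≤ (n : ℤ) + (K : ℤ) * n) ∧
      (-((K : ℤ) * n) ≤ y 1 ∧ y 1 ≤ (K : ℤ) * n) ∧ y 2 = (K : ℤ) * n + 1 := by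
  simp [face, Fintype.mem_piFinset, Fin.forall_fin_succ]

/-- Every index of `Fin 6` is one of the six literals `0, …, 5`. -/
private theorem fin_six_cases (i : Fin 6) : i = 0 ∨ i = 1 ∨ i = 2 ∨ i = 3 ∨ i = 4 ∨ i = 5 := by
  revert i; decide

/-- **(GEO) face geometry** (registered stub `stub_faceGeometry` of line `mirror-face-saturation`):
for `K n + n + 1 ≤ L` the centre `x_n = n e₀` lies in `Λ_L` and on none of the six exterior faces
`face K n i` of the translated plus box `x_n + Λ_{Kn}`, the six faces lie in `Λ_L`, and they are
pairwise disjoint.  Linear integer arithmetic on the coordinates (Friedli–Velenik 2017, §3.2 for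
`Λ_L = {-L,…,L}³`). -/
theorem stub_faceGeometry : FaceGeometry := by
  intro K n L hL
  refine ⟨?_, ?_, ?_, ?_⟩
  · rw [mem_box_three, evalSite_apply_zero, evalSite_apply_one, evalSite_apply_two]
    omega
  · intro i
    rcases fin_six_cases i with rfl | rfl | rfl | rfl | rfl | rfl <;>
    simp only [mem_face_zero, mem_face_one, mem_face_two, mem_face_three, mem_face_four,
      mem_face_five, evalSite_apply_zero, evalSite_apply_one, evalSite_apply_two] <;>
    omega
  · intro i y hy
    rw [mem_box_three]
    rcases fin_six_cases i with rfl | rfl | rfl | rfl | rfl | rfl <;>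
    simp only [mem_face_zero, mem_face_one, mem_face_two, mem_face_three, mem_face_four,
      mem_face_five] at hy <;>
    omega
  · intro i j hij
    rcases fin_six_cases i with rfl | rfl | rfl | rfl | rfl | rfl <;>
    rcases fin_six_cases j with rfl | rfl | rfl | rfl | rfl | rfl <;>
    first
    | exact absurd rfl hij
    | exact Finset.disjoint_left.2 fun y hy hy' => by
        simp only [mem_face_zero, mem_face_one, mem_face_two, mem_face_three, mem_face_four,
          mem_face_five] at hy hy'
        omega

end Summit.CriticalPhenomena.Ising3DConformalLimit.Cruxes.OneArmHyperscaling.MirrorFaceSaturation
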